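import Summits.RiemannHypothesis.RiemannHypothesis.Theorems.PfPersistenceGalerkinClosedFormEngine
import HarnessLib

/-!
# GAL, Markov identity at the cut-off — `L¹` moduli of continuity and uniform jump bounds

Support file 2/3 of barrier-prover's second GAL route (`MarkovAtCutoff`).  For a `C¹` function
`f` with `|f| ≤ M` on `[-b, b]` and `∫_{-b}^{b} |f'| ≤ D`, the cut-off `G_b = 𝟙_{[-b,b]} f` has
`L¹` modulus of continuity `∫ |G_b(x+t) − G_b(x)| dx ≤ (D + 2M)|t|` (Fubini-free proof through
the primitive `Φ(y) = ∫_{-b}^{y} |f'|` and two boundary strips), hence jump forms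
`D_t(G_b) ≤ 2M(D + 2M) t`; the same bound holds for every mollification `G_b ⋆ φ_k`
(`L¹` Young inequality `‖h ⋆ φ‖₁ ≤ ‖h‖₁‖φ‖₁`, Mathlib's `integral_convolution`).  Finally the radius
family is `L²`-Cauchy: `∫ |G_b − G_a|² ≤ 2(a − b)M²`.

RH-free, data-free, no named facts.  Mechanism search only; no RH claims.
-/

set_option linter.dupNamespace false

noncomputable section

open Complex Filter Set MeasureTheory Topology
open scoped Real Convolution ComplexConjugate ContDiff

namespace Summit.RiemannHypothesis.RiemannHypothesis.Theorems.PfPersistence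

open Literature.NumberTheory.LFunctions Literature.NumberTheory.LFunctions.WeilContinuous
open Literature.NumberTheory.LFunctions.ConnesVanSuijlekom

namespace ClosedFormEngine

variable {f f' : ℝ → ℂ} {G h φ : ℝ → ℂ}

/-! ## §1 The primitive of `|f'|` -/

/-- `Φ_b(y) = ∫_{-b}^{y} |f'(u)| du`. [folklore] -/
def derivMass (b : ℝ) (f' : ℝ → ℂ) (y : ℝ) : ℝ := ∫ u in (-b)..y, ‖f' u‖

/-- `|f'|` is interval integrable. [folklore] -/
theorem intervalIntegrable_norm_deriv (hf' : Continuous f') (l r : ℝ) :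
    IntervalIntegrable (fun u ↦ ‖f' u‖) volume l r :=
  (continuous_norm.comp hf').intervalIntegrable l r

/-- `Φ(y₂) − Φ(y₁) = ∫_{y₁}^{y₂} |f'|`. [folklore] -/
theorem derivMass_sub (hf' : Continuous f') (b y₁ y₂ : ℝ) :
    derivMass b f' y₂ - derivMass b f' y₁ = ∫ u in y₁..y₂, ‖f' u‖ := by
  unfold derivMass
  rw [← intervalIntegral.integral_add_adjacent_intervals (intervalIntegrable_norm_deriv hf' (-b) y₁)
    (intervalIntegrable_norm_deriv hf' y₁ y₂)]
  ring

/-- `Φ` is monotone. [folklore] -/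
theorem derivMass_mono (hf' : Continuous f') (b : ℝ) {y₁ y₂ : ℝ} (h : y₁ ≤ y₂) :
    derivMass b f' y₁ ≤ derivMass b f' y₂ := by
  have h1 := derivMass_sub hf' b y₁ y₂
  have h0 : 0 ≤ ∫ u in y₁..y₂, ‖f' u‖ := intervalIntegral.integral_nonneg h fun _ _ ↦ norm_nonneg _
  linarith

/-- `Φ ≥ 0` to the right of `-b`. [folklore] -/
theorem derivMass_nonneg (f' : ℝ → ℂ) {b y : ℝ} (h : -b ≤ y) : 0 ≤ derivMass b f' y :=
  intervalIntegral.integral_nonneg h fun _ _ ↦ norm_nonneg _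

/-- `Φ` is continuous. [folklore] -/
theorem continuous_derivMass (hf' : Continuous f') (b : ℝ) : Continuous (derivMass b f') :=
  intervalIntegral.continuous_primitive (intervalIntegrable_norm_deriv hf') (-b)

/-- **FTC bound**: `|f(y₂) − f(y₁)| ≤ Φ(y₂) − Φ(y₁)` for `y₁ ≤ y₂`. [folklore] -/
theorem norm_sub_le_derivMass_sub (hf : ∀ x, HasDerivAt f (f' x) x) (hf' : Continuous f') (b : ℝ)
    {y₁ y₂ : ℝ} (h : y₁ ≤ y₂) : ‖f y₂ - f y₁‖ ≤ derivMass b f' y₂ - derivMass b f' y₁ := by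
  rw [derivMass_sub hf' b, ← intervalIntegral.integral_eq_sub_of_hasDerivAt (fun x _ ↦ hf x)
    (hf'.intervalIntegrable _ _)]
  exact intervalIntegral.norm_integral_le_integral_norm h

/-! ## §2 The pointwise majorant of `|G_b(x+t) − G_b(x)|` -/

/-- For `t > 0`: `|G_b(x+t) − G_b(x)| ≤ 𝟙_{[-b, b-t]}(Φ(x+t) − Φ(x)) + M 𝟙_{[b-t, b]} + M 𝟙_{[-b-t, -b]}`.
[folklore] -/
theorem norm_cutoffAt_shift_sub_le (hf : ∀ x, HasDerivAt f (f' x) x) (hf' : Continuous f')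
    {b M t : ℝ} (ht : 0 < t) (hM0 : 0 ≤ M) (hM : ∀ x ∈ Icc (-b) b, ‖f x‖ ≤ M) (x : ℝ) :
    ‖cutoffAt b f (x + t) - cutoffAt b f x‖ ≤
      (Icc (-b) (b - t)).indicator (fun x ↦ derivMass b f' (x + t) - derivMass b f' x) x +
        (Icc (b - t) b).indicator (fun _ ↦ M) x + (Icc (-b - t) (-b)).indicator (fun _ ↦ M) x := by
  have i1 : 0 ≤ (Icc (-b) (b - t)).indicator (fun x ↦ derivMass b f' (x + t) - derivMass b f' x) x :=
    Set.indicator_nonneg (fun y _ ↦ sub_nonneg.2 (derivMass_mono hf' b (by linarith))) _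
  have i2 : 0 ≤ (Icc (b - t) b).indicator (fun _ ↦ M) x := Set.indicator_nonneg (fun _ _ ↦ hM0) _
  have i3 : 0 ≤ (Icc (-b - t) (-b)).indicator (fun _ ↦ M) x :=
    Set.indicator_nonneg (fun _ _ ↦ hM0) _
  by_cases hx : x ∈ Icc (-b) b
  · by_cases hxt : x + t ∈ Icc (-b) b
    · have hxm : x ∈ Icc (-b) (b - t) := ⟨hx.1, by linarith [hxt.2]⟩
      simp only [cutoffAt, indicator_of_mem hx, indicator_of_mem hxt]
      rw [indicator_of_mem hxm]
      calc ‖f (x + t) - f x‖ ≤ derivMass b f' (x + t) - derivMass b f' x :=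
            norm_sub_le_derivMass_sub hf hf' b (by linarith)
        _ ≤ _ := by linarith
    · have hxa : x ∈ Icc (b - t) b := by
        refine ⟨?_, hx.2⟩
        by_contra hcon
        exact hxt ⟨by linarith [hx.1], by linarith [not_le.mp hcon]⟩
      simp only [cutoffAt, indicator_of_mem hx, indicator_of_notMem hxt, zero_sub, norm_neg]
      rw [indicator_of_mem hxa]
      linarith [hM x hx]
  · by_cases hxt : x + t ∈ Icc (-b) b
    · have hxa : x ∈ Icc (-b - t) (-b) := by
        refine ⟨by linarith [hxt.1], ?_⟩
        by_contra hcon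
        exact hx ⟨(not_le.mp hcon).le, by linarith [hxt.2]⟩
      simp only [cutoffAt, indicator_of_notMem hx, indicator_of_mem hxt, sub_zero]
      rw [indicator_of_mem hxa]
      linarith [hM (x + t) hxt]
    · simp only [cutoffAt, indicator_of_notMem hx, indicator_of_notMem hxt, sub_self, norm_zero]
      linarith

/-- `∫ 𝟙_{[-b, b-t]} (Φ(·+t) − Φ) ≤ D t` when `Φ(b) ≤ D` (telescoping of the primitive). [folklore] -/
theorem integral_indicator_derivMass_shift_sub_le (hf' : Continuous f') {b D t : ℝ} (hb : 0 ≤ b)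
    (ht : 0 < t) (hD : derivMass b f' b ≤ D) :
    ∫ x, (Icc (-b) (b - t)).indicator (fun x ↦ derivMass b f' (x + t) - derivMass b f' x) x
      ≤ D * t := by
  have hD0 : 0 ≤ D := (derivMass_nonneg f' (by linarith : -b ≤ b)).trans hD
  by_cases hbt : b - t < -b
  · rw [Icc_eq_empty (not_le.2 hbt), indicator_empty]
    simp only [integral_zero]
    positivity
  · have hle : -b ≤ b - t := not_lt.1 hbt
    have hΦc : Continuous (derivMass b f') := continuous_derivMass hf' b
    have hI : ∀ l r, IntervalIntegrable (derivMass b f') volume l r :=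
      fun l r ↦ hΦc.intervalIntegrable l r
    have hIt : IntervalIntegrable (fun x ↦ derivMass b f' (x + t)) volume (-b) (b - t) :=
      (hΦc.comp' (continuous_id.add continuous_const)).intervalIntegrable _ _
    rw [integral_indicator measurableSet_Icc, integral_Icc_eq_integral_Ioc,
      ← intervalIntegral.integral_of_le hle, intervalIntegral.integral_sub hIt (hI _ _),
      intervalIntegral.integral_comp_add_right, sub_add_cancel]
    have e : (∫ x in (-b + t)..b, derivMass b f' x) - ∫ x in (-b)..(b - t), derivMass b f' x =
        (∫ x in (b - t)..b, derivMass b f' x) - ∫ x in (-b)..(-b + t), derivMass b f' x := by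
      have h1 := intervalIntegral.integral_add_adjacent_intervals (hI (-b) (-b + t)) (hI (-b + t) b)
      have h2 := intervalIntegral.integral_add_adjacent_intervals (hI (-b) (b - t)) (hI (b - t) b)
      linarith
    rw [e]
    have h3 : ∫ x in (b - t)..b, derivMass b f' x ≤ ∫ _ in (b - t)..b, D :=
      intervalIntegral.integral_mono_on (by linarith) (hI _ _) intervalIntegrable_const
        fun x hx ↦ (derivMass_mono hf' b hx.2).trans hD
    have h4 : 0 ≤ ∫ x in (-b)..(-b + t), derivMass b f' x :=
      intervalIntegral.integral_nonneg (by linarith) fun x hx ↦ derivMass_nonneg f' hx.1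
    rw [intervalIntegral.integral_const, smul_eq_mul] at h3
    have e2 : (b - (b - t)) * D = D * t := by ring
    linarith

/-! ## §3 The `L¹` modulus of continuity of the cut-off -/

/-- **`L¹` modulus, `t > 0`:** `∫ |G_b(x+t) − G_b(x)| dx ≤ (D + 2M) t`. [folklore] -/
theorem integral_norm_cutoffAt_shift_sub_le_of_pos (hf : ∀ x, HasDerivAt f (f' x) x)
    (hf' : Continuous f') {b M D t : ℝ} (hb : 0 ≤ b) (ht : 0 < t) (hM0 : 0 ≤ M)
    (hM : ∀ x ∈ Icc (-b) b, ‖f x‖ ≤ M) (hD : derivMass b f' b ≤ D) :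
    ∫ x, ‖cutoffAt b f (x + t) - cutoffAt b f x‖ ≤ (D + 2 * M) * t := by
  have hΦc : Continuous (derivMass b f') := continuous_derivMass hf' b
  have hI1 : Integrable fun x ↦ (Icc (-b) (b - t)).indicator
      (fun x ↦ derivMass b f' (x + t) - derivMass b f' x) x :=
    (integrable_indicator_iff measurableSet_Icc).2
      ((hΦc.comp' (continuous_id.add continuous_const)).sub hΦc).integrableOn_Icc
  have hI2 := TestDensity.integrable_indicator_Icc_const (b - t) b M
  have hI3 := TestDensity.integrable_indicator_Icc_const (-b - t) (-b) M
  have hI12 : Integrable fun x ↦ (Icc (-b) (b - t)).indicator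
      (fun x ↦ derivMass b f' (x + t) - derivMass b f' x) x + (Icc (b - t) b).indicator (fun _ ↦ M) x :=
    hI1.add hI2
  have hA := integral_indicator_derivMass_shift_sub_le hf' hb ht hD
  calc ∫ x, ‖cutoffAt b f (x + t) - cutoffAt b f x‖
      ≤ ∫ x, ((Icc (-b) (b - t)).indicator (fun x ↦ derivMass b f' (x + t) - derivMass b f' x) x +
          (Icc (b - t) b).indicator (fun _ ↦ M) x + (Icc (-b - t) (-b)).indicator (fun _ ↦ M) x) :=
        integral_mono_of_nonneg (Eventually.of_forall fun x ↦ norm_nonneg _) (hI12.add hI3)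
          (Eventually.of_forall fun x ↦ norm_cutoffAt_shift_sub_le hf hf' ht hM0 hM x)
    _ = (∫ x, (Icc (-b) (b - t)).indicator (fun x ↦ derivMass b f' (x + t) - derivMass b f' x) x) +
          (b - (b - t)) * M + (-b - (-b - t)) * M := by
        rw [integral_add hI12 hI3, integral_add hI1 hI2,
          TestDensity.integral_indicator_Icc_const (by linarith),
          TestDensity.integral_indicator_Icc_const (by linarith)]
    _ ≤ D * t + (b - (b - t)) * M + (-b - (-b - t)) * M := by linarith
    _ = (D + 2 * M) * t := by ring

/-- **`L¹` modulus, all `t`:** `∫ |G_b(x+t) − G_b(x)| dx ≤ (D + 2M)|t|`. [folklore] -/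
theorem integral_norm_cutoffAt_shift_sub_le (hf : ∀ x, HasDerivAt f (f' x) x) (hf' : Continuous f')
    {b M D : ℝ} (hb : 0 ≤ b) (hM0 : 0 ≤ M) (hM : ∀ x ∈ Icc (-b) b, ‖f x‖ ≤ M)
    (hD : derivMass b f' b ≤ D) (t : ℝ) :
    ∫ x, ‖cutoffAt b f (x + t) - cutoffAt b f x‖ ≤ (D + 2 * M) * |t| := by
  rcases lt_trichotomy t 0 with ht | rfl | ht
  · have e : ∫ x, ‖cutoffAt b f (x + t) - cutoffAt b f x‖ =
        ∫ x, ‖cutoffAt b f (x + -t) - cutoffAt b f x‖ := by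
      rw [← integral_add_right_eq_self (fun x ↦ ‖cutoffAt b f (x + t) - cutoffAt b f x‖) (-t)]
      congr 1
      funext x
      rw [show x + -t + t = x by ring, norm_sub_rev]
    rw [e, abs_of_neg ht]
    exact integral_norm_cutoffAt_shift_sub_le_of_pos hf hf' hb (by linarith) hM0 hM hD
  · have hD0 : 0 ≤ D := (derivMass_nonneg f' (by linarith : -b ≤ b)).trans hD
    simp only [add_zero, sub_self, norm_zero, integral_zero, abs_zero, mul_zero, le_refl]
  · rw [abs_of_pos ht]
    exact integral_norm_cutoffAt_shift_sub_le_of_pos hf hf' hb ht hM0 hM hD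

/-! ## §4 Jump forms of the cut-off and of its mollifications -/

/-- `|G_b| ≤ M` everywhere. [folklore] -/
theorem norm_cutoffAt_le_of_nonneg {b M : ℝ} (hM0 : 0 ≤ M) (hM : ∀ x ∈ Icc (-b) b, ‖f x‖ ≤ M)
    (x : ℝ) : ‖cutoffAt b f x‖ ≤ M :=
  (norm_cutoffAt_le hM x).trans (by rw [max_eq_left hM0])

/-- **Jump forms of the cut-off are linear:** `D_t(G_b) ≤ 2M(D + 2M) t` (`t > 0`). [folklore] -/
theorem weilIncrement_cutoffAt_le (hf : ∀ x, HasDerivAt f (f' x) x) (hf' : Continuous f')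
    {b M D : ℝ} (hb : 0 ≤ b) (hM0 : 0 ≤ M) (hM : ∀ x ∈ Icc (-b) b, ‖f x‖ ≤ M)
    (hD : derivMass b f' b ≤ D) {t : ℝ} (ht : 0 < t) :
    weilIncrement (cutoffAt b f) t ≤ 2 * M * (D + 2 * M) * t := by
  have hfc : Continuous f := continuous_iff_continuousAt.2 fun x ↦ (hf x).continuousAt
  have h1 := weilIncrement_le_mul_integral_norm_sub (norm_cutoffAt_le_of_nonneg hM0 hM)
    (integrable_cutoffAt hfc b) t
  have h2 := integral_norm_cutoffAt_shift_sub_le_of_pos hf hf' hb ht hM0 hM hD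
  calc weilIncrement (cutoffAt b f) t ≤ 2 * M * ∫ x, ‖cutoffAt b f (x + t) - cutoffAt b f x‖ := h1
    _ ≤ 2 * M * ((D + 2 * M) * t) := mul_le_mul_of_nonneg_left h2 (by positivity)
    _ = 2 * M * (D + 2 * M) * t := by ring

/-- Shifting commutes with mollification: `(G ⋆ φ_k)(x+t) − (G ⋆ φ_k)(x) = ((τ_t G − G) ⋆ φ_k)(x)`.
[folklore] -/
theorem weilConv_moll_shift_sub (hGi : Integrable G) (k : ℕ) (t x : ℝ) :
    weilConv G (moll k) (x + t) - weilConv G (moll k) x =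
      weilConv (fun u ↦ G (u + t) - G u) (moll k) x := by
  rw [weilConv_apply, weilConv_apply, weilConv_apply]
  have e1 : ∫ u, G u * moll k (x + t - u) = ∫ u, G (u + t) * moll k (x - u) := by
    rw [← integral_add_right_eq_self (fun u ↦ G u * moll k (x + t - u)) t]
    congr 1
    funext u
    rw [show x + t - (u + t) = x - u by ring]
  rw [e1, ← integral_sub (integrable_mul_moll_sub (hGi.comp_add_right t) k x)
    (integrable_mul_moll_sub hGi k x)]
  congr 1
  funext u
  ring

/-- **`L¹` Young inequality** `‖h ⋆ φ‖₁ ≤ ‖h‖₁ ‖φ‖₁` (via Mathlib's `integral_convolution`). [folklore] -/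
theorem integral_norm_weilConv_le (hh : Integrable h) (hφ : Integrable φ) :
    ∫ x, ‖weilConv h φ x‖ ≤ (∫ x, ‖h x‖) * ∫ x, ‖φ x‖ := by
  have hconv : ∫ x, ((fun u ↦ ‖h u‖) ⋆[ContinuousLinearMap.mul ℝ ℝ, volume] fun u ↦ ‖φ u‖) x =
      (∫ x, ‖h x‖) * ∫ x, ‖φ x‖ := by
    rw [integral_convolution (L := ContinuousLinearMap.mul ℝ ℝ) hh.norm hφ.norm,
      ContinuousLinearMap.mul_apply']
  rw [← hconv]
  refine integral_mono_of_nonneg (Eventually.of_forall fun x ↦ norm_nonneg _)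
    (hh.norm.integrable_convolution (L := ContinuousLinearMap.mul ℝ ℝ) hφ.norm)
    (Eventually.of_forall fun x ↦ ?_)
  dsimp only
  rw [weilConv_apply, convolution_def]
  simp only [ContinuousLinearMap.mul_apply']
  refine (norm_integral_le_integral_norm _).trans (le_of_eq ?_)
  congr 1
  funext u
  rw [norm_mul]

/-- `φ_k` is integrable. [folklore] -/
theorem integrable_moll (k : ℕ) : Integrable (moll k) :=
  (continuous_moll k).integrable_of_hasCompactSupport (hasCompactSupport_moll k)

/-- **Mollification does not increase the `L¹` modulus:**
`∫ |(G ⋆ φ_k)(x+t) − (G ⋆ φ_k)(x)| dx ≤ ∫ |G(x+t) − G(x)| dx`. [folklore] -/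
theorem integral_norm_weilConv_moll_shift_sub_le (hGi : Integrable G) (k : ℕ) (t : ℝ) :
    ∫ x, ‖weilConv G (moll k) (x + t) - weilConv G (moll k) x‖ ≤ ∫ x, ‖G (x + t) - G x‖ := by
  simp only [weilConv_moll_shift_sub hGi k t]
  have h := integral_norm_weilConv_le ((hGi.comp_add_right t).sub hGi) (integrable_moll k)
  rwa [integral_norm_moll, mul_one] at h

/-- **Jump forms of the mollified cut-off are linear, uniformly in `k`:**
`D_t(G_b ⋆ φ_k) ≤ 2M(D + 2M) t` (`t > 0`). [folklore] -/
theorem weilIncrement_weilConv_moll_cutoffAt_le (hf : ∀ x, HasDerivAt f (f' x) x)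
    (hf' : Continuous f') {b M D : ℝ} (hb : 0 ≤ b) (hM0 : 0 ≤ M)
    (hM : ∀ x ∈ Icc (-b) b, ‖f x‖ ≤ M) (hD : derivMass b f' b ≤ D) (k : ℕ) {t : ℝ} (ht : 0 < t) :
    weilIncrement (weilConv (cutoffAt b f) (moll k)) t ≤ 2 * M * (D + 2 * M) * t := by
  have hfc : Continuous f := continuous_iff_continuousAt.2 fun x ↦ (hf x).continuousAt
  have hGi : Integrable (cutoffAt b f) := integrable_cutoffAt hfc b
  have hGs : HasCompactSupport (cutoffAt b f) :=
    HasCompactSupport.intro isCompact_Icc fun x hx ↦ indicator_of_notMem hx f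
  have hT : IsWeilTest (weilConv (cutoffAt b f) (moll k)) :=
    isWeilTest_weilConv_moll_of_locallyIntegrable hGi.locallyIntegrable hGs k
  have hgi : Integrable (weilConv (cutoffAt b f) (moll k)) :=
    hT.1.continuous.integrable_of_hasCompactSupport hT.2
  have h1 := weilIncrement_le_mul_integral_norm_sub
    (norm_weilConv_moll_le (norm_cutoffAt_le_of_nonneg hM0 hM) k) hgi t
  have h2 := (integral_norm_weilConv_moll_shift_sub_le hGi k t).trans
    (integral_norm_cutoffAt_shift_sub_le_of_pos hf hf' hb ht hM0 hM hD)
  calc weilIncrement (weilConv (cutoffAt b f) (moll k)) t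
      ≤ 2 * M * ∫ x, ‖weilConv (cutoffAt b f) (moll k) (x + t) -
          weilConv (cutoffAt b f) (moll k) x‖ := h1
    _ ≤ 2 * M * ((D + 2 * M) * t) := mul_le_mul_of_nonneg_left h2 (by positivity)
    _ = 2 * M * (D + 2 * M) * t := by ring

/-! ## §5 The radius family is `L²`-Cauchy -/

/-- `∫ |G_b − G_a|² ≤ 2(a − b)M²` for `b ≤ a` and `|f| ≤ M` on `[-a, a]`. [folklore] -/
theorem integral_norm_sq_cutoffAt_sub_le {b a M : ℝ} (hba : b ≤ a)
    (hM : ∀ x ∈ Icc (-a) a, ‖f x‖ ≤ M) :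
    ∫ x, ‖cutoffAt b f x - cutoffAt a f x‖ ^ 2 ≤ 2 * (a - b) * M ^ 2 := by
  have hI1 := TestDensity.integrable_indicator_Icc_const (-a) (-b) (M ^ 2)
  have hI2 := TestDensity.integrable_indicator_Icc_const b a (M ^ 2)
  have hpt : ∀ x, ‖cutoffAt b f x - cutoffAt a f x‖ ^ 2 ≤
      (Icc (-a) (-b)).indicator (fun _ ↦ M ^ 2) x + (Icc b a).indicator (fun _ ↦ M ^ 2) x := by
    intro x
    have i1 : 0 ≤ (Icc (-a) (-b)).indicator (fun _ ↦ M ^ 2) x :=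
      Set.indicator_nonneg (fun _ _ ↦ by positivity) _
    have i2 : 0 ≤ (Icc b a).indicator (fun _ ↦ M ^ 2) x :=
      Set.indicator_nonneg (fun _ _ ↦ by positivity) _
    by_cases hxb : x ∈ Icc (-b) b
    · have hxa : x ∈ Icc (-a) a := ⟨by linarith [hxb.1], by linarith [hxb.2]⟩
      simp only [cutoffAt, indicator_of_mem hxb, indicator_of_mem hxa, sub_self, norm_zero, ne_eq,
        OfNat.ofNat_ne_zero, not_false_eq_true, zero_pow]
      linarith
    · by_cases hxa : x ∈ Icc (-a) a
      · simp only [cutoffAt, indicator_of_notMem hxb, indicator_of_mem hxa, zero_sub, norm_neg]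
        have hM2 : ‖f x‖ ^ 2 ≤ M ^ 2 := pow_le_pow_left₀ (norm_nonneg _) (hM x hxa) 2
        by_cases hlt : x < -b
        · have hx1 : x ∈ Icc (-a) (-b) := ⟨hxa.1, hlt.le⟩
          rw [indicator_of_mem hx1]
          linarith
        · have hgt : b < x := by
            by_contra hcon
            exact hxb ⟨not_lt.1 hlt, not_lt.1 hcon⟩
          have hx2 : x ∈ Icc b a := ⟨hgt.le, hxa.2⟩
          rw [indicator_of_mem hx2]
          linarith
      · simp only [cutoffAt, indicator_of_notMem hxb, indicator_of_notMem hxa, sub_self, norm_zero,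
          ne_eq, OfNat.ofNat_ne_zero, not_false_eq_true, zero_pow]
        linarith
  calc ∫ x, ‖cutoffAt b f x - cutoffAt a f x‖ ^ 2
      ≤ ∫ x, ((Icc (-a) (-b)).indicator (fun _ ↦ M ^ 2) x + (Icc b a).indicator (fun _ ↦ M ^ 2) x) :=
        integral_mono_of_nonneg (Eventually.of_forall fun x ↦ by positivity) (hI1.add hI2)
          (Eventually.of_forall hpt)
    _ = (-b - -a) * M ^ 2 + (a - b) * M ^ 2 := by
        rw [integral_add hI1 hI2, TestDensity.integral_indicator_Icc_const (by linarith),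
          TestDensity.integral_indicator_Icc_const (by linarith)]
    _ = 2 * (a - b) * M ^ 2 := by ring

end ClosedFormEngine

end Summit.RiemannHypothesis.RiemannHypothesis.Theorems.PfPersistence
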